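/-
Copyright (c) 2026 the pub-hodgecm-mathlib formalisation cell (harness21).  Prover seat hodgecm-mathlib-LH4-p02 (g12): STAGE 1a «(D-RAM) FOUR-FRAME» road, unit
U3 (S)-side, TARGET B of LH4-p11 (g0)'s DATUM §4–§5 list (dealer LH4-plan (g10) WORD #34 (3)): the exact fixed-vertex rule on a sub-building; 2026-09-03.
-/
import Summits.HodgeConjecture.HodgeConjecture.Theorems.F0P3cDyRamDiagonalTubeFixed   -- ★ p855052 (LH4-p11 (g0)): `mulVec_diagonal_eq_smul_add_sum`, `mapGL_eq_of_diagonal_of_forall_single_mem`; brings ★ `mapGL`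
import HarnessLib

/-!
# Crux `H413`, line LH4 «(D-RAM) FOUR-FRAME», unit U3 (S)-side: THE EXACT FIXED-VERTEX RULE ON A SUB-BUILDING — for `T = diag(s)` with unit entries and a lattice
# `M` stable under the coordinate idempotent `E_ii`, `T·M = M ↔ (s_j − s_k)·E_jj·M ≤ M`

Cell `hodgecm-mathlib` (D-0151), FLOOR 0, crux item H413 = `stmt-HodgeConjecture-24833`, route of record `HCCMUnconditional`; squad F0∕P3c∕LH4 Track A; dealer
LH4-plan (g10) WORD #34 (3) — TARGET B of LH4-p11 (g0)'s (S)-side intermediate targets toward `stub_U3_stableLaw_RU` (signature signed by p11, 22:00:11Z, typed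
here VERBATIM).  THEOREMS ONLY (no `def`, no instance, no notation, no `sorry`, default heartbeats); generic valued field, `t`-free, `κ`-free; lane
`--supports stmt-HodgeConjecture-24833 --as helper`.

WHAT IS PROVED.  `mapGL_diagonal_eq_iff_of_single_mem`: for `s : Fin 3 → K` with `|s_i| = 1`, `T = diag(s)`, `{i, j, k} = Fin 3`, and an `𝒪`-lattice `M ≤ K³` with
`x_i·e_i ∈ M` for all `x ∈ M` (`M` is `E_ii`-stable: a vertex of the sub-building `B_i`), `mapGL T M = M ↔ ∀ x ∈ M, (s_j − s_k)·x_j·e_j ∈ M`.  «⇐» is ★ p855052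
`mapGL_eq_of_diagonal_of_forall_single_mem` at the slot `k` (the `i`-term `(s_i − s_k)·x_i·e_i` is an `𝒪`-multiple of `x_i·e_i ∈ M`); «⇒»: `T x ∈ T·M = M` and
`T x − s_k·x = (s_i − s_k)·x_i·e_i + (s_j − s_k)·x_j·e_j` (★ `mulVec_diagonal_eq_smul_add_sum` read coordinatewise; the `k`-term vanishes), so the `j`-term is a
difference of members of `M`.  MEANING (DATUM §5): along `B_i` a vertex is fixed by `diag(s)` iff `c_j(M) ≤ v(s_j − s_k)` — the exact census rule on the sub-building.

HONEST LABEL.  Count-neutral helper (`--supports 24833`) for the (S)-side payers of U3.  (D-RAM) verdict of record PRINT [LanglandsShelstad1989 Thm. p. 484 ∕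
Rogawski1990 Prop. 4.9.1 (a)] ∕ XL; `HC_CM` is proved only modulo the 7 printed citations (2 remaining: hLiu418 = `stmt-HodgeConjecture-24832`, h413 =
`stmt-HodgeConjecture-24833`) until rung 0 closes.

## References
* [Kottwitz1986BaseChangeUnits] R. Kottwitz, *Base change for unit elements of Hecke algebras*, Compositio Math. 60 (1986), §1 pp. 240–241 (fixed vertices of a
  torus element in the building; distance to the apartment).
* [Serre1980Trees] J.-P. Serre, *Trees* (1980), Ch. II §1.1 (lattices and the tree∕building of `GL`).
* [BruhatTits1972] F. Bruhat, J. Tits, *Groupes réductifs sur un corps local I*, Publ. Math. IHÉS 41 (1972), §10 (fixed points of bounded subgroups).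
-/

noncomputable section

namespace Summit.HodgeConjecture.HodgeConjecture.Cruxes.H413.F0P3cDyRamDiagonalSubBuildingFixed

open Matrix
open Literature.NumberTheory.Automorphic Literature.NumberTheory.Automorphic.HermitianLattice
open Literature.NumberTheory.Automorphic.UnitaryLatticeTree
open Summit.HodgeConjecture.HodgeConjecture.Cruxes.H413.F0P3cDyRamDiagonalTubeFixed
open scoped Valued WithZero Matrix MatrixGroups

/-- Three pairwise distinct elements exhaust `Fin 3`: any `l ≠ k` is `i` or `j`. [cite: Serre1980Trees, II §1.1] -/
theorem fin_three_eq_or_eq_of_ne {i j k l : Fin 3} (hij : i ≠ j) (hik : i ≠ k) (hjk : j ≠ k) (hlk : l ≠ k) : l = i ∨ l = j := by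
  revert i j k l
  decide

/-- `diag(s)·x − s_k·x = (s_i − s_k)·x_i·e_i + (s_j − s_k)·x_j·e_j` on `K³` with `{i, j, k} = Fin 3` (the `k`-coordinate vanishes). [cite: Serre1980Trees, II §1.1] -/
theorem diagonal_mulVec_sub_smul_eq {K : Type*} [Field K] (s : Fin 3 → K) (x : Fin 3 → K) {i j k : Fin 3} (hij : i ≠ j) (hik : i ≠ k) (hjk : j ≠ k) :
    (Matrix.diagonal s).mulVec x - s k • x = (s i - s k) • (Pi.single i (x i) : Fin 3 → K) + (s j - s k) • (Pi.single j (x j) : Fin 3 → K) := by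
  funext l
  rw [Pi.sub_apply, Matrix.mulVec_diagonal, Pi.smul_apply, Pi.add_apply, Pi.smul_apply, Pi.smul_apply, smul_eq_mul, smul_eq_mul, smul_eq_mul]
  by_cases hlk : l = k
  · subst hlk
    rw [Pi.single_eq_of_ne (Ne.symm hik), Pi.single_eq_of_ne (Ne.symm hjk), mul_zero, mul_zero, add_zero, sub_self]
  · rcases fin_three_eq_or_eq_of_ne hij hik hjk hlk with rfl | rfl
    · rw [Pi.single_eq_same, Pi.single_eq_of_ne hij, mul_zero, add_zero]; ring
    · rw [Pi.single_eq_same, Pi.single_eq_of_ne (Ne.symm hij), mul_zero, zero_add]; ring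

/-- **THE EXACT FIXED-VERTEX RULE ON A SUB-BUILDING** (TARGET B of LH4-p11 (g0)'s (S)-side list, VERBATIM): for `T = diag(s)` with unit entries, `{i, j, k} = Fin 3`,
and an `E_ii`-stable lattice `M` (`x_i·e_i ∈ M` for `x ∈ M`), `T·M = M ↔ ∀ x ∈ M, (s_j − s_k)·x_j·e_j ∈ M` — on the sub-building `B_i` a vertex is fixed iff
`c_j(M) ≤ v(s_j − s_k)`.  «⇐» ★ `mapGL_eq_of_diagonal_of_forall_single_mem` at slot `k`; «⇒» `T x ∈ M` and the coordinate identity above.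
[cite: Kottwitz1986BaseChangeUnits, §1 pp. 240–241] [cite: Serre1980Trees, II §1.1] [cite: BruhatTits1972, §10] -/
theorem mapGL_diagonal_eq_iff_of_single_mem {K : Type*} [Field K] [Valued K ℤᵐ⁰] (s : Fin 3 → K) (hs : ∀ i, Valued.v (s i) = 1) (T : GL (Fin 3) K)
    (hT : (T : Matrix (Fin 3) (Fin 3) K) = Matrix.diagonal s) (M : Submodule 𝒪[K] (Fin 3 → K)) {i j k : Fin 3} (hij : i ≠ j) (hik : i ≠ k) (hjk : j ≠ k)
    (hi : ∀ x ∈ M, (Pi.single i (x i) : Fin 3 → K) ∈ M) :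
    mapGL T M = M ↔ ∀ x ∈ M, (s j - s k) • (Pi.single j (x j) : Fin 3 → K) ∈ M := by
  -- the `i`-term is always in `M`: an `𝒪`-multiple of `x_i·e_i`
  have hiterm : ∀ x ∈ M, (s i - s k) • (Pi.single i (x i) : Fin 3 → K) ∈ M := fun x hx =>
    M.smul_mem (⟨s i - s k, (Valuation.map_sub _ _ _).trans (max_le (hs i).le (hs k).le)⟩ : 𝒪[K]) (hi x hx)
  constructor
  · -- «⇒»: `T x ∈ M`, `s_k·x ∈ M`, and the coordinate identity isolate the `j`-term
    intro hfix x hx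
    have hTx : (Matrix.diagonal s).mulVec x ∈ M := by
      have h : ((Matrix.toLin' (T : Matrix (Fin 3) (Fin 3) K)).restrictScalars 𝒪[K]) x ∈ mapGL T M := Submodule.mem_map_of_mem hx
      rwa [hfix, LinearMap.restrictScalars_apply, Matrix.toLin'_apply, hT] at h
    have hdiff : (Matrix.diagonal s).mulVec x - s k • x ∈ M := M.sub_mem hTx (M.smul_mem (⟨s k, (hs k).le⟩ : 𝒪[K]) hx)
    rw [diagonal_mulVec_sub_smul_eq s x hij hik hjk] at hdiff
    have h := M.sub_mem hdiff (hiterm x hx)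
    rwa [add_sub_cancel_left] at h
  · -- «⇐»: the tube criterion at slot `k`
    intro h
    refine mapGL_eq_of_diagonal_of_forall_single_mem s hs T hT k M fun l hlk x hx => ?_
    rcases fin_three_eq_or_eq_of_ne hij hik hjk hlk with rfl | rfl
    · exact hiterm x hx
    · exact h x hx

end Summit.HodgeConjecture.HodgeConjecture.Cruxes.H413.F0P3cDyRamDiagonalSubBuildingFixed

end
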